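import Summits.ValiantsHypothesis.ValiantsHypothesis.Theorems.NewtonUnitEquationsTwoProductsTowerRecordDefs

/-!
# val-idea-35 g8 — «hyperbolic class cross» sketch (crux stmt-ValiantsHypothesis-5906 `TwoProducts`, wave-4 brief R330)

Scratch, statements only (`def … : Prop`), kernel-checked for elaboration; nothing here is proved in Lean,
nothing closes 5906 / `PlanarCellBound` / `ResidualLawV25`; VP ≠ VNP is NOT proved.

MODEL (bi-tower = R13's tower model with TWO level directions).  Carriers `x_i ∈ ℕ²` (`i < n`), two level
directions `d₁ d₂ ∈ ℤ²`, letters `x_i + e•d₁` and `x_i + e'•d₂` (or, for general bidegree pencils, `x_i + e•d₁ + e'•d₂`);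
the `2m` pencils `γ j i ∈ ℂ[z₁,z₂]` (`z_c = y^{d_c}`); the CLASS POLYNOMIAL of a carrier multiset `S`
is `Δp_S = Σ_j Π_i γ_{j i}^{S_i} − Σ_j Π_i γ'_{j i}^{S_i}`; a pair `(S,k)` (`k ∈ ℕ²` a level exponent) is LIVE when
`[z^k] Δp_S ≠ 0`, its planar point is `Σ S_i x_i + k₀•d₁ + k₁•d₂`, and it is a RECORD at `ξ` when it is the strict
`ξ`-heaviest live pair of size `≤ M`.
-/

noncomputable section
set_option linter.dupNamespace false

namespace Summit.ValiantsHypothesis.ValiantsHypothesis.Cruxes.TwoProducts.ValIdea35g8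

open scoped BigOperators
open MvPolynomial
open Summit.ValiantsHypothesis.ValiantsHypothesis.Theorems.NewtonUnitEquations.TwoProducts.FormalLogLinearisation
open Summit.ValiantsHypothesis.ValiantsHypothesis.Theorems.NewtonUnitEquations.TwoProducts.MomentRecord
open Summit.ValiantsHypothesis.ValiantsHypothesis.Theorems.NewtonUnitEquations.TwoProducts.PlanarCell

variable {m n : ℕ}

/-- Bi-tower pencils: `γ j i ∈ ℂ[z₁,z₂]`. -/
abbrev Pencil2 (m n : ℕ) := Fin m → Fin n → MvPolynomial (Fin 2) ℂ

/-- Moment polynomial of the carrier multiset `S`: `Σ_j Π_i γ_{j i}^{S_i}`. -/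
def momentPoly2 (γ : Pencil2 m n) (S : Fin n → ℕ) : MvPolynomial (Fin 2) ℂ := ∑ j, ∏ i, γ j i ^ S i

/-- Class polynomial `Δp_S`. -/
def classPoly2 (γ γ' : Pencil2 m n) (S : Fin n → ℕ) : MvPolynomial (Fin 2) ℂ := momentPoly2 γ S - momentPoly2 γ' S

/-- The layer `[z^k] Δp_S`. -/
def layer2 (γ γ' : Pencil2 m n) (k : Fin 2 →₀ ℕ) (S : Fin n → ℕ) : ℂ := coeff k (classPoly2 γ γ' S)

/-- Planar point of the pair `(S,k)`: `Σ S_i x_i + k 0 • d₁ + k 1 • d₂`. -/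
def pt2 (x : Fin n → Expo) (d₁ d₂ : Fin 2 → ℤ) (S : Fin n → ℕ) (k : Fin 2 →₀ ℕ) : Fin 2 → ℤ :=
  fun c => (∑ i, ((S i : ℕ) : ℤ) * ((x i c : ℕ) : ℤ)) + ((k 0 : ℕ) : ℤ) * d₁ c + ((k 1 : ℕ) : ℤ) * d₂ c

/-- Live pairs of size `≤ M`. -/
def live2 (γ γ' : Pencil2 m n) (M : ℕ) : Set ((Fin n → ℕ) × (Fin 2 →₀ ℕ)) :=
  {p | size p.1 ≤ M ∧ layer2 γ γ' p.2 p.1 ≠ 0}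

/-- `(S,k)` is a RECORD at `ξ` among live pairs of size `≤ M`. -/
def IsRecord2 (γ γ' : Pencil2 m n) (x : Fin n → Expo) (d₁ d₂ : Fin 2 → ℤ) (M : ℕ) (ξ : Fin 2 → ℝ)
    (p : (Fin n → ℕ) × (Fin 2 →₀ ℕ)) : Prop :=
  p ∈ live2 γ γ' M ∧ ∀ q ∈ live2 γ γ' M, q ≠ p → wtZ ξ (pt2 x d₁ d₂ q.1 q.2) < wtZ ξ (pt2 x d₁ d₂ p.1 p.2)

/-- SEPARATED («cross») pencils: every monomial of every `γ j i` is a pure power of `z₁` or of `z₂` (constants allowed),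
i.e. `γ_{j i} = φ_{j i}(z₁) + ψ_{j i}(z₂)`; letters `x_i + E₁•d₁ ∪ x_i + E₂•d₂` with ARBITRARY level sets. -/
def Separated2 (γ : Pencil2 m n) : Prop := ∀ j i, ∀ μ ∈ (γ j i).support, μ 0 = 0 ∨ μ 1 = 0

/-- **K1 — HYPERBOLIC CLASS CROSS** (paper-proved this session; the lever).  A record class `S` (record against the live
pairs of size `≤ M`, `2|S| ≤ M`) satisfies `Π_i (S_i + 1) ≤ 2m`: ARBITRARY bidegree pencils, any carriers, any two
directions, no dissociation, no box, no level hypothesis.  (Proof: the `Π(S_i+1) > 2m` vectors `(γ_j^β)_{j} ∈ ℂ[z]^{2m}`,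
`β ≤ S`, are `ℂ(z)`-dependent; multiply the relation by `γ_j^{S−β*}` for the `β*` maximising `v_ξ(g_β) − ξ•(β•x)`;
the `β*` summand's `ξ`-leading form is strictly the heaviest because every other class `S − β* + β` is live-lighter than
the record — leading forms multiply in the domain `ℂ[z₁,z₂]`.) -/
def HyperbolicClassCross : Prop :=
  ∀ (m n M : ℕ) (γ γ' : Pencil2 m n) (x : Fin n → Expo) (d₁ d₂ : Fin 2 → ℤ) (ξ : Fin 2 → ℝ)
    (S : Fin n → ℕ) (k : Fin 2 →₀ ℕ),
    2 * size S ≤ M → IsRecord2 γ γ' x d₁ d₂ M ξ (S, k) → ∏ i, (S i + 1) ≤ 2 * m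

/-- **K1′ — CLASS RANK BUDGET** (separated pencils).  The record layers of ONE class `S` over ALL `ξ` are vertices of
`Newt(Δp_S)`, and `Δp_S = Σ_j Π_i (φ_{ji}+ψ_{ji})^{S_i} − …` has `(z₁|z₂)`-rank `≤ 2m·Π(S_i+1)`, so (in-tree planar rank
lemma, four quadrants) at most `8m·Π(S_i+1)` of them — free of heights, level counts and collisions inside the class. -/
def ClassRankBudget : Prop :=
  ∀ (m n M : ℕ) (γ γ' : Pencil2 m n) (x : Fin n → Expo) (d₁ d₂ : Fin 2 → ℤ) (S : Fin n → ℕ),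
    Separated2 γ → Separated2 γ' →
    {k : Fin 2 →₀ ℕ | ∃ ξ : Fin 2 → ℝ, IsRecord2 γ γ' x d₁ d₂ M ξ (S, k)}.ncard ≤ 8 * m * ∏ i, (S i + 1)

/-- **K2 — BI-TOWER VERTEX WALK** (OPEN; the crux of the card).  The number of record CLASSES along the circle of
directions is `≤ 2^{am}·(t+2)^b` when `n ≤ 2mt` — the two-direction analogue of ✓ `TowerRecord.VertexWalkBound`
(`≤ 4mn+4` letter sets in ONE direction).  Today only the quasi-polynomial count `#(hyperbolic cross) ≤ 2(2mn)^{1+log₂ m}`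
(from K1) is known; the sweep potential of the 1-D proof does not transplant (the slope of an item carries a level part that
is not modular in the carrier set). -/
def BiTowerVertexWalk : Prop :=
  ∃ a b : ℕ, ∀ (m n t M : ℕ) (γ γ' : Pencil2 m n) (x : Fin n → Expo) (d₁ d₂ : Fin 2 → ℤ),
    n ≤ 2 * m * t →
    {S : Fin n → ℕ | ∃ (ξ : Fin 2 → ℝ) (k : Fin 2 →₀ ℕ), 2 * size S ≤ M ∧ IsRecord2 γ γ' x d₁ d₂ M ξ (S, k)}.ncard
      ≤ 2 ^ (a * m) * (t + 2) ^ b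

/-- Bi-tower dissociation to depth `M` inside the level box `D₁ × D₂` (the Lift's hypothesis; the BOUNDS below are box-free). -/
def BiTowerDissociated (x : Fin n → Expo) (d₁ d₂ : Fin 2 → ℤ) (M D₁ D₂ : ℕ) : Prop :=
  ∀ (S S' : Fin n → ℕ) (k k' : Fin 2 →₀ ℕ), size S ≤ M → size S' ≤ M →
    k 0 ≤ D₁ * size S → k 1 ≤ D₂ * size S → k' 0 ≤ D₁ * size S' → k' 1 ≤ D₂ * size S' →
    pt2 x d₁ d₂ S k = pt2 x d₁ d₂ S' k' → (S = S' ∧ k = k')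

/-- The CROSS-TOWER alphabet hypothesis: every tail letter is `x_i + e•d₁` (`e ≤ D₁`) or `x_i + e•d₂` (`e ≤ D₂`). -/
def CrossAlphabet (u v : Fin m → MvPolynomial (Fin 2) ℂ) (x : Fin n → Expo) (d₁ d₂ : Fin 2 → ℤ) (D₁ D₂ : ℕ) : Prop :=
  ∀ e ∈ tailSupport u v, ∃ i : Fin n, (∃ j : ℕ, j ≤ D₁ ∧ ∀ c, ((e c : ℕ) : ℤ) = ((x i c : ℕ) : ℤ) + (j : ℤ) * d₁ c) ∨
    (∃ j : ℕ, j ≤ D₂ ∧ ∀ c, ((e c : ℕ) : ℤ) = ((x i c : ℕ) : ℤ) + (j : ℤ) * d₂ c)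

/-- **TOY LAW, DECIDED ON PAPER (K1 + K1′ + trivial count of the hyperbolic cross + bidegree Lift):** on a cross-tower
alphabet over carriers bi-tower-dissociated to depth `2m`, every cell family has at most
`32 m² · (4m²t)^{1 + log₂ m}` points — QUASI-POLYNOMIAL, free of `D₁, D₂`, of the level sets and of all collisions inside
a carrier class; two independent shift directions.  (For `n ≤ n₀` carriers: `≤ 16m²·#{S ∈ ℕ^{n₀} : Π(S_i+1) ≤ 2m}`,
t-free and height-free.) -/
def CrossTowerQuasiPolyLaw : Prop :=
  ∀ (m t n D₁ D₂ : ℕ) (u v : Fin m → MvPolynomial (Fin 2) ℂ) (x : Fin n → Expo) (d₁ d₂ : Fin 2 → ℤ),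
    2 ≤ t →
    (∀ j, MvPolynomial.coeff 0 (u j) = 0 ∧ (u j).support.card ≤ t) →
    (∀ j, MvPolynomial.coeff 0 (v j) = 0 ∧ (v j).support.card ≤ t) →
    CrossAlphabet u v x d₁ d₂ D₁ D₂ → BiTowerDissociated x d₁ d₂ (2 * m) D₁ D₂ →
    ∀ (R : Expo → Expo → Prop) (S : Finset Expo), IsCellFamily u v R S →
      S.card ≤ 32 * m ^ 2 * (4 * m ^ 2 * t) ^ (Nat.log 2 m + 1)

/-- **CLASS RUNG TARGET (K1 + K1′ + K2 + Lift): CROSS-TOWER CARRIER LAW** — the box-free two-direction analogue of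
✓ `TowerRecord.LevelFreeCarrierLaw` (R13∞, one direction, `(a,b) = (11,1)`). In 5906's currency. -/
def CrossTowerCarrierLaw : Prop :=
  ∃ a b : ℕ, ∀ (m t n D₁ D₂ : ℕ) (u v : Fin m → MvPolynomial (Fin 2) ℂ) (x : Fin n → Expo) (d₁ d₂ : Fin 2 → ℤ),
    2 ≤ t →
    (∀ j, MvPolynomial.coeff 0 (u j) = 0 ∧ (u j).support.card ≤ t) →
    (∀ j, MvPolynomial.coeff 0 (v j) = 0 ∧ (v j).support.card ≤ t) →
    CrossAlphabet u v x d₁ d₂ D₁ D₂ → BiTowerDissociated x d₁ d₂ (2 * m) D₁ D₂ →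
    ∀ (R : Expo → Expo → Prop) (S : Finset Expo), IsCellFamily u v R S → S.card ≤ 2 ^ (a * m) * (t + 2) ^ b

/-- The card's assembly inside the crux (shape only): the three items give the class rung. -/
def cardAssembly : Prop := HyperbolicClassCross → ClassRankBudget → BiTowerVertexWalk → CrossTowerCarrierLaw

end Summit.ValiantsHypothesis.ValiantsHypothesis.Cruxes.TwoProducts.ValIdea35g8
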